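import Summits.FinalStateConjecture.FinalStateConjecture.Theorems.ClusterCompletenessAdiabaticMultiKerrILEDAwayFromHorizon
import Summits.FinalStateConjecture.FinalStateConjecture.Theorems.ClusterCompletenessAdiabaticMultiKerrILEDRestFrameDegenerateILED
import Summits.FinalStateConjecture.FinalStateConjecture.Theorems.ClusterCompletenessAdiabaticMultiKerrILEDRedShiftLocal
import Summits.FinalStateConjecture.FinalStateConjecture.Theorems.ClusterCompletenessAdiabaticMultiKerrILEDTailsCutWaveOperatorFacts
import Summits.FinalStateConjecture.FinalStateConjecture.Theorems.ClusterCompletenessAdiabaticMultiKerrILEDLeafMassEnergy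
import Summits.FinalStateConjecture.FinalStateConjecture.Theorems.ClusterCompletenessAdiabaticMultiKerrILEDLeafHardyDecayPropagate

/-!
# Route ClusterCompleteness — crux `AdiabaticMultiKerrILED`, line `Sketch`:
# the rest-frame integrated local energy decay with loss of one derivative (zero spin)

Helper file for the crux `stmt-FinalStateConjecture-14310`
(`Summit.FinalStateConjecture.FinalStateConjecture.Theses.ClusterCompleteness.AdiabaticMultiKerrILED`),
line `Sketch`, registered stub `restFrame_ILED_zeroSpin` (lead c7, wave 9): THE ASSEMBLY.

For the static tails-cut Schwarzschild zone `g_χ(0)` of mass `M` in its rest frame (Kerr–Schild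
form `G₀`), tilted leaves `{x⁰ = u + F(y)}` of slope `≤ 1/2`, and a `C³` solution `Φ` of
`□_{G₀}Φ = 0` on `{F ≤ x⁰} ∩ {r > 2M}` whose initial leaf function has the Hardy decay
`∫_{ρ₀<‖y‖} Φ²/‖y‖² < ∞` and whose energies and commuted energies stay bounded
(`E[Φ](s) ≤ C_E E[Φ](0)`, `E[∂₀Φ](s) ≤ C_E E[∂₀Φ](0)` — the landed zero-spin boundedness
`energyBound_zeroSpin_single` supplies `C_E`):
`∫_0^∞ ∫_{2M<‖y‖≤R_z} (∑_μ(∂_μΦ)² + Φ²/M²) ≤ C (1 + C_E) (E[Φ](0) + E[∂₀Φ](0))`.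
Ingredients (all landed): the degenerate Morawetz estimate `restFrame_degenerateILED_zeroSpin` for
`Φ` and for `∂₀Φ` (which solves the same equation, `waveOperator_tailsCut_timeDeriv_eq_zero`), the
non-degenerate upgrade away from the collar `restFrame_ILED_awayFromHorizon`, the red-shift collar
`collar_ILED_le` (here as the private copy `collar_ILED_le_aux`), the leaf Hardy inputs `leaf_mass_le_energy`, `leaf_hardyDecay_propagate`,
`leaf_hardyDecay_of_energy`, and the shell domination `morawetzBulk_dominates`; the limit `s → ∞`
is monotone convergence over `(0, n]`. Dafermos–Rodnianski arXiv:0811.0354, §4 (the `X`-estimate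
with loss of one derivative at the photon sphere); DRSR arXiv:1402.7034, §13.2. [folklore]
-/

noncomputable section

-- the doubled `FinalStateConjecture.FinalStateConjecture` path component trips dupNamespace
set_option linter.dupNamespace false

open Set Filter MeasureTheory
open scoped Topology ENNReal BigOperators
open Literature.Geometry.Lorentzian

namespace Summit.FinalStateConjecture.FinalStateConjecture.Theorems

/-- **The horizon collar of the rest-frame ILED at zero spin** (local copy of the landed `collar_ILED_le`, whose module the farm has not built yet): for `M > 0` there are a collar width `0 < η ≤ M/4` and a constant `C` such that
for every `C²` height `F` of slope `≤ 1/2`, every `Φ ∈ C²(ℝ⁴)` solving the tails-cut wave equation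
on `{F ≤ x⁰} ∩ {r > 2M}`, and every `s ≥ 0`,
`∫_{(0,s]} ∫_{2M<‖y‖≤2M+η/2} e[Φ] ≤ C (∫_{2M<‖y‖} e[Φ](leaf 0) + ∫_{(0,s]} ∫_{2M+η/2≤‖y‖≤2M+η} e[Φ])`
(`e[Φ] = ∑_μ(∂_μΦ)²` at the leaf point `(u + F(y), y)`). This is `stub_redShiftLocal` at `a = 0`,
`c = 1/2`, with the equation transferred by `waveOperator_tailsCut_eq_schwarzschild`.
DRSR arXiv:1402.7034, Prop. 4.5.2. [cite: DafermosRodnianskiShlapentokhrothman2014, Prop. 4.5.2] -/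
private theorem collar_ILED_le_aux : ∀ (M : ℝ), 0 < M → ∃ η : ℝ, 0 < η ∧ η ≤ M / 4 ∧ ∃ C : NNReal, ∀ (F : E3 → ℝ) (Φ : E4 → ℝ) (s : ℝ), ContDiff ℝ 2 F → (∀ y, ‖fderiv ℝ F y‖ ≤ 2⁻¹) → ContDiff ℝ 2 Φ → (∀ x : E4, F (E4.spatial x) ≤ x 0 → 2 * M < Kerr.radius 0 x → KerrSchild.waveOperator (KerrSchild.inverseMetric (fun y ↦ Real.smoothTransition (2 - Kerr.radius 0 y / (8 * M)) * (2 * Kerr.scalarH M 0 y)) (Kerr.nullVector 0)) Φ x = 0) → 0 ≤ s → ∫⁻ u in Set.Ioc 0 s, ∫⁻ y in {y : E3 | 2 * M < ‖y‖ ∧ ‖y‖ ≤ 2 * M + η / 2}, ENNReal.ofReal (∑ μ : Fin 4, fderiv ℝ Φ (E4.ofTimeSpace (u + F y) y) (E4.basisVector μ) ^ 2) ≤ (C : ENNReal) * ((∫⁻ y in {y : E3 | 2 * M < ‖y‖}, ENNReal.ofReal (∑ μ : Fin 4, fderiv ℝ Φ (E4.ofTimeSpace (0 + F y) y) (E4.basisVector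 μ) ^ 2)) + ∫⁻ u in Set.Ioc 0 s, ∫⁻ y in {y : E3 | 2 * M + η / 2 ≤ ‖y‖ ∧ ‖y‖ ≤ 2 * M + η}, ENNReal.ofReal (∑ μ : Fin 4, fderiv ℝ Φ (E4.ofTimeSpace (u + F y) y) (E4.basisVector μ) ^ 2)) := by
  intro M hM
  have hsub : Kerr.IsSubextremal M 0 := by
    show |(0 : ℝ)| < M
    simpa using hM
  obtain ⟨η₀, hη₀, hRS⟩ :=
    Summit.FinalStateConjecture.FinalStateConjecture.Cruxes.AdiabaticMultiKerrILED.Sketch.stub_redShiftLocal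
      M 0 hsub
  set η : ℝ := min η₀ (M / 4) with hηdef
  have hη : 0 < η := lt_min hη₀ (by positivity)
  have hηη₀ : η ≤ η₀ := min_le_left _ _
  have hη4 : η ≤ M / 4 := min_le_right _ _
  obtain ⟨Crs, hCrs, hest⟩ := hRS η hη hηη₀
  refine ⟨η, hη, hη4, (ENNReal.ofReal (Crs / 2⁻¹)).toNNReal, ?_⟩
  intro F Φ s hF hdF hΦ hsol hs
  rw [ENNReal.coe_toNNReal ENNReal.ofReal_ne_top]
  have hrp : Kerr.rPlus M 0 = 2 * M := Kerr.rPlus_zero_right hM.le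
  have hrad : ∀ (t : ℝ) (y : E3), Kerr.radius 0 (E4.ofTimeSpace t y) = ‖y‖ := fun t y ↦ by
    rw [Kerr.radius_zero_left, E4.spatialNorm_ofTimeSpace]
  -- the hypotheses of the red-shift estimate
  have hslope : ∀ y, ‖fderiv ℝ F y‖ ≤ 1 - 2⁻¹ := fun y ↦ (hdF y).trans_eq (by norm_num)
  have hreg : ∀ x ∈ (Kerr.exterior M 0 : Set E4), ContDiffAt ℝ 2 Φ x := fun x _ ↦ hΦ.contDiffAt
  have heq : ∀ x ∈ (Kerr.exterior M 0 : Set E4), Kerr.radius 0 x ≤ Kerr.rPlus M 0 + η →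
      F (E4.spatial x) ≤ x 0 →
      KerrSchild.waveOperator
        (KerrSchild.inverseMetric (fun y ↦ 2 * Kerr.scalarH M 0 y) (Kerr.nullVector 0)) Φ x = 0 := by
    intro x hx hxη hxF
    have hx' : 2 * M < Kerr.radius 0 x := by
      have h := (Kerr.mem_exterior.mp hx)
      rw [hrp] at h
      exact lt_of_le_of_lt (le_max_left _ _) h
    have h8 : Kerr.radius 0 x < 8 * M := by rw [hrp] at hxη; linarith
    rw [← waveOperator_tailsCut_eq_schwarzschild M Φ x hM h8]
    exact hsol x hxF hx'
  have h := hest F 2⁻¹ hF (by norm_num) (by norm_num) hslope Φ hreg heq s hs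
  -- rewrite radii and horizon radius on the leaves, indicators as set integrals
  simp only [hrad, hrp] at h
  have e1 : ∀ (t : ℝ) (a b : ℝ),
      (∫⁻ y, {y : E3 | a < ‖y‖ ∧ ‖y‖ ≤ b}.indicator (fun y ↦ ENNReal.ofReal
        (∑ μ : Fin 4, fderiv ℝ Φ (E4.ofTimeSpace (t + F y) y) (E4.basisVector μ) ^ 2)) y) =
      ∫⁻ y in {y : E3 | a < ‖y‖ ∧ ‖y‖ ≤ b}, ENNReal.ofReal
        (∑ μ : Fin 4, fderiv ℝ Φ (E4.ofTimeSpace (t + F y) y) (E4.basisVector μ) ^ 2) :=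
    fun t a b ↦ lintegral_indicator (measurableSet_norm_Ioc a b) _
  have e2 : ∀ (t : ℝ) (a b : ℝ),
      (∫⁻ y, {y : E3 | a ≤ ‖y‖ ∧ ‖y‖ ≤ b}.indicator (fun y ↦ ENNReal.ofReal
        (∑ μ : Fin 4, fderiv ℝ Φ (E4.ofTimeSpace (t + F y) y) (E4.basisVector μ) ^ 2)) y) =
      ∫⁻ y in {y : E3 | a ≤ ‖y‖ ∧ ‖y‖ ≤ b}, ENNReal.ofReal
        (∑ μ : Fin 4, fderiv ℝ Φ (E4.ofTimeSpace (t + F y) y) (E4.basisVector μ) ^ 2) :=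
    fun t a b ↦ lintegral_indicator (measurableSet_norm_Icc a b) _
  simp only [e1, e2] at h
  -- drop the leaf term on the left, enlarge the initial collar energy to the full energy
  calc ∫⁻ u in Set.Ioc 0 s, ∫⁻ y in {y : E3 | 2 * M < ‖y‖ ∧ ‖y‖ ≤ 2 * M + η / 2},
        ENNReal.ofReal (∑ μ : Fin 4, fderiv ℝ Φ (E4.ofTimeSpace (u + F y) y) (E4.basisVector μ) ^ 2)
      ≤ _ := le_add_self
    _ ≤ _ := h
    _ ≤ _ := by
        refine mul_le_mul_right (add_le_add (lintegral_mono_set fun y hy ↦ hy.1) le_rfl) _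


set_option maxHeartbeats 400000 in
/-- **Rest-frame ILED with loss of one derivative, zero spin** (crux `AdiabaticMultiKerrILED`,
line `Sketch`, stub `restFrame_ILED_zeroSpin`): see the module docstring.
Dafermos–Rodnianski arXiv:0811.0354, §4. [folklore] -/
theorem restFrame_ILED_zeroSpin : ∀ (M Rz : ℝ), 0 < M → ∃ C : NNReal, ∀ (F : E3 → ℝ) (Φ : E4 → ℝ) (CE : NNReal), ContDiff ℝ 2 F → (∀ y, ‖fderiv ℝ F y‖ ≤ 2⁻¹) → ContDiff ℝ 3 Φ → (∀ x : E4, F (E4.spatial x) ≤ x 0 → 2 * M < Kerr.radius 0 x → KerrSchild.waveOperator (KerrSchild.inverseMetric (fun y ↦ Real.smoothTransition (2 - Kerr.radius 0 y / (8 * M)) * (2 * Kerr.scalarH M 0 y)) (Kerr.nullVector 0)) Φ x = 0) → (∃ ρ₀ : ℝ, ∫⁻ y in {y : E3 | ρ₀ < ‖y‖}, ENNReal.ofReal (Φ (E4.ofTimeSpace (0 + F y) y) ^ 2 / ‖y‖ ^ 2) < ⊤) → (∀ s : ℝ, 0 ≤ s → (∫⁻ y in {y : E3 | 2 * M < ‖y‖},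 ENNReal.ofReal (∑ μ : Fin 4, fderiv ℝ Φ (E4.ofTimeSpace (s + F y) y) (E4.basisVector μ) ^ 2)) ≤ (CE : ENNReal) * (∫⁻ y in {y : E3 | 2 * M < ‖y‖}, ENNReal.ofReal (∑ μ : Fin 4, fderiv ℝ Φ (E4.ofTimeSpace (0 + F y) y) (E4.basisVector μ) ^ 2))) → (∀ s : ℝ, 0 ≤ s → (∫⁻ y in {y : E3 | 2 * M < ‖y‖}, ENNReal.ofReal (∑ μ : Fin 4, fderiv ℝ (fun z ↦ fderiv ℝ Φ z (E4.basisVector 0)) (E4.ofTimeSpace (s + F y) y) (E4.basisVector μ) ^ 2)) ≤ (CE : ENNReal) * (∫⁻ y in {y : E3 | 2 * M < ‖y‖}, ENNReal.ofReal (∑ μ : Fin 4, fderiv ℝ (fun z ↦ fderiv ℝ Φ z (E4.basisVector 0)) (E4.ofTimeSpace (0 + F y) y) (E4.basisVector μ) ^ 2))) → ∫⁻ u in Set.Ioi (0 : ℝ), ∫⁻ y in {y : E3 | 2 * M < ‖y‖ ∧ ‖y‖ ≤ Rz}, (ENNReal.ofReal (∑ μ : Fin 4, fderiv ℝ Φ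 (E4.ofTimeSpace (u + F y) y) (E4.basisVector μ) ^ 2) + ENNReal.ofReal (Φ (E4.ofTimeSpace (u + F y) y) ^ 2 / M ^ 2)) ≤ (C : ENNReal) * (1 + (CE : ENNReal)) * ((∫⁻ y in {y : E3 | 2 * M < ‖y‖}, ENNReal.ofReal (∑ μ : Fin 4, fderiv ℝ Φ (E4.ofTimeSpace (0 + F y) y) (E4.basisVector μ) ^ 2)) + (∫⁻ y in {y : E3 | 2 * M < ‖y‖}, ENNReal.ofReal (∑ μ : Fin 4, fderiv ℝ (fun z ↦ fderiv ℝ Φ z (E4.basisVector 0)) (E4.ofTimeSpace (0 + F y) y) (E4.basisVector μ) ^ 2))) := by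
  intro M Rz hM
  obtain ⟨η, hη, hη4, Crs, hcol⟩ := collar_ILED_le_aux M hM
  obtain ⟨K, hK⟩ := restFrame_ILED_awayFromHorizon M (η / 2) Rz hM (half_pos hη) (by linarith)
  obtain ⟨CW, hW⟩ := restFrame_degenerateILED_zeroSpin M hM
  obtain ⟨KP, hKP0, hP⟩ := morawetzBulk_dominates M (η / 2) (9 * M) hM (half_pos hη)
  obtain ⟨CH, hCH⟩ := leaf_mass_le_energy M hM
  set crs : ℝ≥0∞ := (Crs : ℝ≥0∞) with hcrs
  set k : ℝ≥0∞ := (K : ℝ≥0∞) with hk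
  set cw : ℝ≥0∞ := (CW : ℝ≥0∞) with hcw
  set kp : ℝ≥0∞ := ENNReal.ofReal KP with hkp
  set ch : ℝ≥0∞ := (CH : ℝ≥0∞) with hch
  set Ccol : ℝ≥0∞ := crs * (1 + kp * cw) with hCcol
  set Cat : ℝ≥0∞ := cw + cw + Ccol + 1 + 1 + ch + ch with hCat
  set Ctot : ℝ≥0∞ := Ccol + k * Cat + 1 with hCtot
  have hCfin : Ctot ≠ ⊤ := by simp only [hCtot, hCat, hCcol, hcrs, hk, hcw, hkp, hch]; finiteness
  refine ⟨Ctot.toNNReal, ?_⟩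
  intro F Φ CE hF hdF hΦ hsol hdec hE hEd
  rw [ENNReal.coe_toNNReal hCfin, mul_assoc]
  -- ### abbreviations
  set Φd : E4 → ℝ := fun z ↦ fderiv ℝ Φ z (E4.basisVector 0) with hΦd
  set ce : ℝ≥0∞ := (CE : ℝ≥0∞) with hce
  set E0 : ℝ≥0∞ := ∫⁻ y in {y : E3 | 2 * M < ‖y‖}, ENNReal.ofReal (∑ μ : Fin 4, fderiv ℝ Φ (E4.ofTimeSpace (0 + F y) y) (E4.basisVector μ) ^ 2) with hE0
  set Ed0 : ℝ≥0∞ := ∫⁻ y in {y : E3 | 2 * M < ‖y‖}, ENNReal.ofReal (∑ μ : Fin 4, fderiv ℝ Φd (E4.ofTimeSpace (0 + F y) y) (E4.basisVector μ) ^ 2) with hEd0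
  set X : ℝ≥0∞ := (1 + ce) * (E0 + Ed0) with hX
  -- ### the trivial case of infinite data
  by_cases htop : E0 = ⊤ ∨ Ed0 = ⊤
  · have h1 : (1 + ce) ≠ 0 := ne_of_gt (lt_of_lt_of_le one_pos le_self_add)
    have hXtop : X = ⊤ := by
      simp only [hX]
      rcases htop with h | h
      · rw [h, top_add, ENNReal.mul_top h1]
      · rw [h, add_top, ENNReal.mul_top h1]
    have hC0 : Ctot ≠ 0 := by simp only [hCtot]; exact fun h ↦ one_ne_zero (add_eq_zero.mp h).2
    calc _ ≤ (⊤ : ℝ≥0∞) := le_top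
      _ = Ctot * X := by rw [hXtop, ENNReal.mul_top hC0]
  push Not at htop
  obtain ⟨hE0top, hEd0top⟩ := htop
  -- ### regularity and the commuted equation
  have hΦ2 : ContDiff ℝ 2 Φ := hΦ.of_le (by norm_num)
  have hΦ1 : ContDiff ℝ 1 Φ := hΦ.of_le (by norm_num)
  have hF1 : ContDiff ℝ 1 F := hF.of_le (by norm_num)
  have hΦd2 : ContDiff ℝ 2 Φd := (hΦ.fderiv_right (m := 2) (by norm_num)).clm_apply contDiff_const
  have hΦd1 : ContDiff ℝ 1 Φd := hΦd2.of_le (by norm_num)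
  have hsold : ∀ x : E4, F (E4.spatial x) ≤ x 0 → 2 * M < Kerr.radius 0 x →
      KerrSchild.waveOperator (KerrSchild.inverseMetric (fun y ↦ Real.smoothTransition
        (2 - Kerr.radius 0 y / (8 * M)) * (2 * Kerr.scalarH M 0 y)) (Kerr.nullVector 0)) Φd x = 0 :=
    fun x h1 h2 ↦ waveOperator_tailsCut_timeDeriv_eq_zero M F Φ x hM hΦ hsol h1 h2
  -- ### energies and their bounds
  have hE' : ∀ s, 0 ≤ s → (∫⁻ y in {y : E3 | 2 * M < ‖y‖}, ENNReal.ofReal (∑ μ : Fin 4,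
      fderiv ℝ Φ (E4.ofTimeSpace (s + F y) y) (E4.basisVector μ) ^ 2)) ≤ ce * E0 := hE
  have hg_le_e : ∀ x : E4, fderiv ℝ Φ x (E4.basisVector 0) ^ 2 ≤
      ∑ μ : Fin 4, fderiv ℝ Φ x (E4.basisVector μ) ^ 2 := fun x ↦
    Finset.single_le_sum (f := fun μ : Fin 4 ↦ fderiv ℝ Φ x (E4.basisVector μ) ^ 2)
      (fun μ _ ↦ sq_nonneg _) (Finset.mem_univ 0)
  -- Hardy decay of `Φ` on every leaf (propagated from the initial leaf)
  have hdecay : ∀ s, 0 ≤ s → ∃ ρ₀ : ℝ, ∫⁻ y in {y : E3 | ρ₀ < ‖y‖},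
      ENNReal.ofReal (Φ (E4.ofTimeSpace (s + F y) y) ^ 2 / ‖y‖ ^ 2) < ⊤ := by
    intro s hs
    obtain ⟨ρ₀, hρ₀⟩ := hdec
    set ρ : ℝ := max ρ₀ (2 * M + 1) with hρ
    have hρpos : 0 < ρ := lt_of_lt_of_le (by linarith) (le_max_right _ _)
    have hρM : 2 * M < ρ := lt_of_lt_of_le (by linarith) (le_max_right _ _)
    refine ⟨ρ, leaf_hardyDecay_propagate F Φ s ρ hF1 hΦ1 hs hρpos ?_ ?_⟩
    · exact lt_of_le_of_lt (lintegral_mono_set fun y (hy : ρ < ‖y‖) ↦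
        show ρ₀ < ‖y‖ from lt_of_le_of_lt (le_max_left _ _) hy) hρ₀
    · have h1 : ∀ u ∈ Set.Ioc (0 : ℝ) s, (∫⁻ y in {y : E3 | ρ < ‖y‖},
          ENNReal.ofReal (fderiv ℝ Φ (E4.ofTimeSpace (u + F y) y) (E4.basisVector 0) ^ 2)) ≤ ce * E0 := by
        intro u hu
        calc (∫⁻ y in {y : E3 | ρ < ‖y‖},
              ENNReal.ofReal (fderiv ℝ Φ (E4.ofTimeSpace (u + F y) y) (E4.basisVector 0) ^ 2))
            ≤ ∫⁻ y in {y : E3 | ρ < ‖y‖}, ENNReal.ofReal (∑ μ : Fin 4,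
                fderiv ℝ Φ (E4.ofTimeSpace (u + F y) y) (E4.basisVector μ) ^ 2) :=
              lintegral_mono fun y ↦ ENNReal.ofReal_le_ofReal (hg_le_e _)
          _ ≤ ∫⁻ y in {y : E3 | 2 * M < ‖y‖}, ENNReal.ofReal (∑ μ : Fin 4,
                fderiv ℝ Φ (E4.ofTimeSpace (u + F y) y) (E4.basisVector μ) ^ 2) :=
              lintegral_mono_set fun y (hy : ρ < ‖y‖) ↦ show 2 * M < ‖y‖ from hρM.trans hy
          _ ≤ ce * E0 := hE' u hu.1.le
      calc ∫⁻ u in Set.Ioc 0 s, ∫⁻ y in {y : E3 | ρ < ‖y‖},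
            ENNReal.ofReal (fderiv ℝ Φ (E4.ofTimeSpace (u + F y) y) (E4.basisVector 0) ^ 2)
          ≤ ∫⁻ u in Set.Ioc (0 : ℝ) s, ce * E0 := setLIntegral_mono' measurableSet_Ioc h1
        _ = ce * E0 * volume (Set.Ioc (0 : ℝ) s) := setLIntegral_const _ _
        _ < ⊤ := by
            refine ENNReal.mul_lt_top (ENNReal.mul_lt_top ENNReal.coe_lt_top hE0top.lt_top) ?_
            rw [Real.volume_Ioc]; exact ENNReal.ofReal_lt_top
  -- Hardy decay of `∂₀Φ` on every leaf (finite energy)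
  have hdecayd : ∀ s, 0 ≤ s → ∃ ρ₀ : ℝ, ∫⁻ y in {y : E3 | ρ₀ < ‖y‖},
      ENNReal.ofReal (Φd (E4.ofTimeSpace (s + F y) y) ^ 2 / ‖y‖ ^ 2) < ⊤ := by
    intro s hs
    refine ⟨2 * M + 1, lt_of_le_of_lt (leaf_hardyDecay_of_energy (M := M) (ρ := 2 * M + 1)
      (by linarith) (by linarith) F Φ s) ?_⟩
    exact ENNReal.mul_lt_top ENNReal.ofReal_lt_top
      (lt_of_le_of_lt (hE' s hs) (ENNReal.mul_lt_top ENNReal.coe_lt_top hE0top.lt_top))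
  -- ### the degenerate Morawetz estimate for `Φ` and for `∂₀Φ`
  set DΦ : ℝ≥0∞ := ∫⁻ u in Set.Ioi (0 : ℝ), ∫⁻ y in {y : E3 | 2 * M < ‖y‖}, ENNReal.ofReal ((fun (x : E4) ↦ (((Kerr.radius 0 x - 2 * M) * M ^ 3 * (Kerr.radius 0 x - 3 * M) ^ 2 / (2 * Kerr.radius 0 x ^ 7)) * fderiv ℝ Φ x (E4.basisVector 0) ^ 2 + (3 * M / (20 * Kerr.radius 0 x ^ 2)) * ((1 - (Real.smoothTransition (2 - Kerr.radius 0 x / (8 * M)) * (2 * Kerr.scalarH M 0 x))) * (∑ i : Fin 3, x i.succ * fderiv ℝ Φ x (E4.basisVector i.succ)) / Kerr.radius 0 x + (Real.smoothTransition (2 - Kerr.radius 0 x / (8 * M)) * (2 * Kerr.scalarH M 0 x)) * fderiv ℝ Φ x (E4.basisVector 0)) ^ 2 + ((Kerr.radius 0 x - 3 * M) ^ 2 / (8 * Kerr.radius 0 x ^ 3)) * ((∑ i : Fin 3, fderiv ℝ Φ x (E4.basisVector i.succ) ^ 2) - ((∑ i : Fin 3, x i.succ * fderiv ℝ Φ x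 (E4.basisVector i.succ)) / Kerr.radius 0 x) ^ 2) + (if 7 * M ≤ Kerr.radius 0 x then M * (Kerr.radius 0 x - 7 * M) / (4 * Kerr.radius 0 x ^ 5) else 0) * Φ x ^ 2)) (E4.ofTimeSpace (u + F y) y)) with hDΦ
  set DΦd : ℝ≥0∞ := ∫⁻ u in Set.Ioi (0 : ℝ), ∫⁻ y in {y : E3 | 2 * M < ‖y‖}, ENNReal.ofReal ((fun (x : E4) ↦ (((Kerr.radius 0 x - 2 * M) * M ^ 3 * (Kerr.radius 0 x - 3 * M) ^ 2 / (2 * Kerr.radius 0 x ^ 7)) * fderiv ℝ Φd x (E4.basisVector 0) ^ 2 + (3 * M / (20 * Kerr.radius 0 x ^ 2)) * ((1 - (Real.smoothTransition (2 - Kerr.radius 0 x / (8 * M)) * (2 * Kerr.scalarH M 0 x))) * (∑ i : Fin 3, x i.succ * fderiv ℝ Φd x (E4.basisVector i.succ)) / Kerr.radius 0 x + (Real.smoothTransition (2 - Kerr.radius 0 x / (8 * M)) * (2 * Kerr.scalarH M 0 x)) * fderiv ℝ Φd x (E4.basisVector 0)) ^ 2 + ((Kerr.radius 0 x - 3 *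 M) ^ 2 / (8 * Kerr.radius 0 x ^ 3)) * ((∑ i : Fin 3, fderiv ℝ Φd x (E4.basisVector i.succ) ^ 2) - ((∑ i : Fin 3, x i.succ * fderiv ℝ Φd x (E4.basisVector i.succ)) / Kerr.radius 0 x) ^ 2) + (if 7 * M ≤ Kerr.radius 0 x then M * (Kerr.radius 0 x - 7 * M) / (4 * Kerr.radius 0 x ^ 5) else 0) * Φd x ^ 2)) (E4.ofTimeSpace (u + F y) y)) with hDΦd
  have hWΦ : DΦ ≤ cw * (1 + ce) * E0 := hW F Φ CE hF hdF hΦ2 hsol hdecay hE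
  have hWΦd : DΦd ≤ cw * (1 + ce) * Ed0 := hW F Φd CE hF hdF hΦd2 hsold hdecayd hEd
  -- ### atoms in terms of `X`
  have hX1 : E0 + Ed0 ≤ X := by
    simp only [hX]
    calc E0 + Ed0 = 1 * (E0 + Ed0) := (one_mul _).symm
      _ ≤ (1 + ce) * (E0 + Ed0) := mul_le_mul_left le_self_add _
  have aE0 : E0 ≤ X := le_self_add.trans hX1
  have aEd0 : Ed0 ≤ X := le_add_self.trans hX1
  have aCE : ce * E0 ≤ X := by
    simp only [hX]
    exact mul_le_mul' le_add_self le_self_add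
  have aDΦ : DΦ ≤ cw * X := by
    refine hWΦ.trans ?_
    rw [mul_assoc]
    exact mul_le_mul_right (mul_le_mul_right le_self_add _) _
  have aDΦd : DΦd ≤ cw * X := by
    refine hWΦd.trans ?_
    rw [mul_assoc]
    exact mul_le_mul_right (mul_le_mul_right le_add_self _) _
  -- ### the integrand and the sets
  set L : ℝ → E3 → E4 := fun u y ↦ E4.ofTimeSpace (u + F y) y with hL
  set fe : E4 → ℝ := fun x ↦ ∑ μ : Fin 4, fderiv ℝ Φ x (E4.basisVector μ) ^ 2 with hfe
  set ie : ℝ → E3 → ℝ≥0∞ := fun u y ↦ ENNReal.ofReal (fe (L u y)) with hie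
  set iz : ℝ → E3 → ℝ≥0∞ := fun u y ↦ ENNReal.ofReal (Φ (L u y) ^ 2 / M ^ 2) with hiz
  have hfe_c : Continuous fe := by
    have hcfd : Continuous (fderiv ℝ Φ) := hΦ1.continuous_fderiv one_ne_zero
    simp only [hfe]
    fun_prop
  have hLc : Continuous (Function.uncurry L) := by
    simp only [hL]
    exact E4.continuous_ofTimeSpace_uncurry.comp
      ((continuous_fst.add (hF.continuous.comp continuous_snd)).prodMk continuous_snd)
  have mie : Measurable (Function.uncurry ie) :=
    ENNReal.measurable_ofReal.comp (hfe_c.measurable.comp hLc.measurable)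
  have hrad : ∀ u y, Kerr.radius 0 (L u y) = ‖y‖ := fun u y ↦ by
    simp only [hL, Kerr.radius_zero_left, E4.spatialNorm_ofTimeSpace]
  set ZR : Set E3 := {y : E3 | 2 * M < ‖y‖ ∧ ‖y‖ ≤ Rz} with hZR
  set COL : Set E3 := {y : E3 | 2 * M < ‖y‖ ∧ ‖y‖ ≤ 2 * M + η / 2} with hCOL
  set COL' : Set E3 := {y : E3 | 2 * M < ‖y‖ ∧ ‖y‖ < 2 * M + η / 2} with hCOL'
  set AW : Set E3 := {y : E3 | 2 * M + η / 2 ≤ ‖y‖ ∧ ‖y‖ ≤ Rz} with hAW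
  set SHELL : Set E3 := {y : E3 | 2 * M + η / 2 ≤ ‖y‖ ∧ ‖y‖ ≤ 2 * M + η} with hSHELL
  set Ω : Set E3 := {y : E3 | 2 * M < ‖y‖} with hΩ
  have mSHELL : MeasurableSet SHELL := measurableSet_norm_Icc _ _
  have ZR_sub : ZR ⊆ COL ∪ AW := by
    intro y hy
    simp only [hZR, hCOL, hAW, Set.mem_union, Set.mem_setOf_eq] at hy ⊢
    by_cases h : ‖y‖ ≤ 2 * M + η / 2
    · exact Or.inl ⟨hy.1, h⟩
    · exact Or.inr ⟨by linarith, hy.2⟩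
  have COL'_sub : COL' ⊆ COL := fun y hy ↦ ⟨hy.1, hy.2.le⟩
  have SHELL_sub : SHELL ⊆ Ω := fun y hy ↦ by
    simp only [hSHELL, hΩ, Set.mem_setOf_eq] at hy ⊢; linarith [hy.1]
  -- the designed bulk dominates the energy density on the shell
  have hP1 : ∀ x, 2 * M + η / 2 ≤ Kerr.radius 0 x → Kerr.radius 0 x ≤ 9 * M →
      (Kerr.radius 0 x ≤ 5 * M / 2 ∨ 7 * M / 2 ≤ Kerr.radius 0 x) → fe x ≤ KP * (((Kerr.radius 0 x - 2 * M) * M ^ 3 * (Kerr.radius 0 x - 3 * M) ^ 2 / (2 * Kerr.radius 0 x ^ 7)) * fderiv ℝ Φ x (E4.basisVector 0) ^ 2 + (3 * M / (20 * Kerr.radius 0 x ^ 2)) * ((1 - (Real.smoothTransition (2 - Kerr.radius 0 x / (8 * M)) * (2 * Kerr.scalarH M 0 x))) * (∑ i : Fin 3, x i.succ * fderiv ℝ Φ x (E4.basisVector i.succ)) / Kerr.radius 0 x + (Real.smoothTransition (2 - Kerr.radius 0 x / (8 * M)) * (2 * Kerr.scalarH M 0 x)) * fderiv ℝ Φ x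 (E4.basisVector 0)) ^ 2 + ((Kerr.radius 0 x - 3 * M) ^ 2 / (8 * Kerr.radius 0 x ^ 3)) * ((∑ i : Fin 3, fderiv ℝ Φ x (E4.basisVector i.succ) ^ 2) - ((∑ i : Fin 3, x i.succ * fderiv ℝ Φ x (E4.basisVector i.succ)) / Kerr.radius 0 x) ^ 2) + (if 7 * M ≤ Kerr.radius 0 x then M * (Kerr.radius 0 x - 7 * M) / (4 * Kerr.radius 0 x ^ 5) else 0) * Φ x ^ 2) :=
    fun x h1 h2 h3 ↦ (hP Φ x ((hΦ1.differentiable one_ne_zero) x)).1 h1 h2 h3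
  -- ### the bound on each finite slab `(0, n]`
  have hstep : ∀ n : ℕ, (∫⁻ u in Set.Ioc (0 : ℝ) n, ∫⁻ y in ZR, (ie u y + iz u y)) ≤ Ctot * X := by
    intro n
    have hn : (0 : ℝ) ≤ n := n.cast_nonneg
    -- slab notation at height `n`
    have eD : (∫⁻ u in Set.Ioc (0 : ℝ) n, ∫⁻ y in Ω, ENNReal.ofReal ((fun (x : E4) ↦ (((Kerr.radius 0 x - 2 * M) * M ^ 3 * (Kerr.radius 0 x - 3 * M) ^ 2 / (2 * Kerr.radius 0 x ^ 7)) * fderiv ℝ Φ x (E4.basisVector 0) ^ 2 + (3 * M / (20 * Kerr.radius 0 x ^ 2)) * ((1 - (Real.smoothTransition (2 - Kerr.radius 0 x / (8 * M)) * (2 * Kerr.scalarH M 0 x))) * (∑ i : Fin 3, x i.succ * fderiv ℝ Φ x (E4.basisVector i.succ)) / Kerr.radius 0 x + (Real.smoothTransition (2 - Kerr.radius 0 x / (8 * M)) * (2 * Kerr.scalarH M 0 x)) * fderiv ℝ Φ x (E4.basisVector 0)) ^ 2 + ((Kerr.radius 0 x - 3 * M) ^ 2 / (8 * Kerr.radius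 0 x ^ 3)) * ((∑ i : Fin 3, fderiv ℝ Φ x (E4.basisVector i.succ) ^ 2) - ((∑ i : Fin 3, x i.succ * fderiv ℝ Φ x (E4.basisVector i.succ)) / Kerr.radius 0 x) ^ 2) + (if 7 * M ≤ Kerr.radius 0 x then M * (Kerr.radius 0 x - 7 * M) / (4 * Kerr.radius 0 x ^ 5) else 0) * Φ x ^ 2)) (L u y))) ≤ DΦ :=
      lintegral_mono' (Measure.restrict_mono Set.Ioc_subset_Ioi_self le_rfl) le_rfl
    have eDd : (∫⁻ u in Set.Ioc (0 : ℝ) n, ∫⁻ y in Ω, ENNReal.ofReal ((fun (x : E4) ↦ (((Kerr.radius 0 x - 2 * M) * M ^ 3 * (Kerr.radius 0 x - 3 * M) ^ 2 / (2 * Kerr.radius 0 x ^ 7)) * fderiv ℝ Φd x (E4.basisVector 0) ^ 2 + (3 * M / (20 * Kerr.radius 0 x ^ 2)) * ((1 - (Real.smoothTransition (2 - Kerr.radius 0 x / (8 * M)) * (2 * Kerr.scalarH M 0 x))) * (∑ i : Fin 3, x i.succ * fderiv ℝ Φd x (E4.basisVector i.succ)) / Kerr.radius 0 x + (Real.smoothTransition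 (2 - Kerr.radius 0 x / (8 * M)) * (2 * Kerr.scalarH M 0 x)) * fderiv ℝ Φd x (E4.basisVector 0)) ^ 2 + ((Kerr.radius 0 x - 3 * M) ^ 2 / (8 * Kerr.radius 0 x ^ 3)) * ((∑ i : Fin 3, fderiv ℝ Φd x (E4.basisVector i.succ) ^ 2) - ((∑ i : Fin 3, x i.succ * fderiv ℝ Φd x (E4.basisVector i.succ)) / Kerr.radius 0 x) ^ 2) + (if 7 * M ≤ Kerr.radius 0 x then M * (Kerr.radius 0 x - 7 * M) / (4 * Kerr.radius 0 x ^ 5) else 0) * Φd x ^ 2)) (L u y))) ≤ DΦd :=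
      lintegral_mono' (Measure.restrict_mono Set.Ioc_subset_Ioi_self le_rfl) le_rfl
    -- the shell by the bulk
    have hSH : (∫⁻ u in Set.Ioc (0 : ℝ) n, ∫⁻ y in SHELL, ie u y) ≤ kp * DΦ := by
      calc (∫⁻ u in Set.Ioc (0 : ℝ) n, ∫⁻ y in SHELL, ie u y)
          ≤ ∫⁻ u in Set.Ioc (0 : ℝ) n, ∫⁻ y in SHELL, kp * ENNReal.ofReal ((fun (x : E4) ↦ (((Kerr.radius 0 x - 2 * M) * M ^ 3 * (Kerr.radius 0 x - 3 * M) ^ 2 / (2 * Kerr.radius 0 x ^ 7)) * fderiv ℝ Φ x (E4.basisVector 0) ^ 2 + (3 * M / (20 * Kerr.radius 0 x ^ 2)) * ((1 - (Real.smoothTransition (2 - Kerr.radius 0 x / (8 * M)) * (2 * Kerr.scalarH M 0 x))) * (∑ i : Fin 3, x i.succ * fderiv ℝ Φ x (E4.basisVector i.succ)) / Kerr.radius 0 x + (Real.smoothTransition (2 - Kerr.radius 0 x / (8 * M)) * (2 * Kerr.scalarH M 0 x)) * fderiv ℝ Φ x (E4.basisVector 0)) ^ 2 + ((Kerr.radius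 0 x - 3 * M) ^ 2 / (8 * Kerr.radius 0 x ^ 3)) * ((∑ i : Fin 3, fderiv ℝ Φ x (E4.basisVector i.succ) ^ 2) - ((∑ i : Fin 3, x i.succ * fderiv ℝ Φ x (E4.basisVector i.succ)) / Kerr.radius 0 x) ^ 2) + (if 7 * M ≤ Kerr.radius 0 x then M * (Kerr.radius 0 x - 7 * M) / (4 * Kerr.radius 0 x ^ 5) else 0) * Φ x ^ 2)) (L u y)) := by
            refine slab_lintegral_mono_fun mSHELL fun u y hy ↦ ?_
            simp only [hSHELL, Set.mem_setOf_eq] at hy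
            have hr := hrad u y
            rw [hkp, ← ENNReal.ofReal_mul hKP0]
            refine ENNReal.ofReal_le_ofReal (hP1 _ ?_ ?_ ?_)
            · rw [hr]; exact hy.1
            · rw [hr]; linarith [hy.2]
            · rw [hr]; exact Or.inl (by linarith [hy.2])
        _ = kp * ∫⁻ u in Set.Ioc (0 : ℝ) n, ∫⁻ y in SHELL, ENNReal.ofReal ((fun (x : E4) ↦ (((Kerr.radius 0 x - 2 * M) * M ^ 3 * (Kerr.radius 0 x - 3 * M) ^ 2 / (2 * Kerr.radius 0 x ^ 7)) * fderiv ℝ Φ x (E4.basisVector 0) ^ 2 + (3 * M / (20 * Kerr.radius 0 x ^ 2)) * ((1 - (Real.smoothTransition (2 - Kerr.radius 0 x / (8 * M)) * (2 * Kerr.scalarH M 0 x))) * (∑ i : Fin 3, x i.succ * fderiv ℝ Φ x (E4.basisVector i.succ)) / Kerr.radius 0 x + (Real.smoothTransition (2 - Kerr.radius 0 x / (8 * M)) * (2 * Kerr.scalarH M 0 x)) * fderiv ℝ Φ x (E4.basisVector 0)) ^ 2 + ((Kerr.radius 0 x - 3 * M) ^ 2 / (8 * Kerr.radius 0 x ^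 3)) * ((∑ i : Fin 3, fderiv ℝ Φ x (E4.basisVector i.succ) ^ 2) - ((∑ i : Fin 3, x i.succ * fderiv ℝ Φ x (E4.basisVector i.succ)) / Kerr.radius 0 x) ^ 2) + (if 7 * M ≤ Kerr.radius 0 x then M * (Kerr.radius 0 x - 7 * M) / (4 * Kerr.radius 0 x ^ 5) else 0) * Φ x ^ 2)) (L u y)) :=
            slab_lintegral_const_mul _ ENNReal.ofReal_ne_top
        _ ≤ kp * DΦ := mul_le_mul_right ((slab_lintegral_mono_set _ SHELL_sub).trans eD) _
    -- the collar by the red-shift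
    have hC : (∫⁻ u in Set.Ioc (0 : ℝ) n, ∫⁻ y in COL, ie u y) ≤ Ccol * X := by
      have h := hcol F Φ n hF hdF hΦ2 hsol hn
      calc (∫⁻ u in Set.Ioc (0 : ℝ) n, ∫⁻ y in COL, ie u y) ≤ crs * (E0 + _) := h
        _ ≤ crs * (X + kp * DΦ) := mul_le_mul_right (add_le_add aE0 hSH) _
        _ ≤ crs * (X + kp * (cw * X)) := mul_le_mul_right (add_le_add le_rfl (mul_le_mul_right aDΦ _)) _
        _ = Ccol * X := by simp only [hCcol]; ring
    -- leaf masses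
    have hP0 : (∫⁻ y in {y : E3 | 2 * M < ‖y‖ ∧ ‖y‖ ≤ 9 * M}, ENNReal.ofReal (Φ (L 0 y) ^ 2)) ≤ ch * X :=
      (hCH F Φ 0 hF1 hdF hΦ1 (hdecay 0 le_rfl)).trans (mul_le_mul_right aE0 _)
    have hPn : (∫⁻ y in {y : E3 | 2 * M < ‖y‖ ∧ ‖y‖ ≤ 9 * M}, ENNReal.ofReal (Φ (L n y) ^ 2)) ≤ ch * X :=
      (hCH F Φ n hF1 hdF hΦ1 (hdecay n hn)).trans (mul_le_mul_right ((hE' n hn).trans aCE) _)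
    -- away from the collar (stub 9b-ii)
    have hA : (∫⁻ u in Set.Ioc (0 : ℝ) n, ∫⁻ y in AW, ie u y) +
        (∫⁻ u in Set.Ioc (0 : ℝ) n, ∫⁻ y in ZR, iz u y) ≤ k * (Cat * X) := by
      have h := hK F Φ n hF hdF hΦ hsol hn
      calc (∫⁻ u in Set.Ioc (0 : ℝ) n, ∫⁻ y in AW, ie u y) + (∫⁻ u in Set.Ioc (0 : ℝ) n, ∫⁻ y in ZR, iz u y)
          ≤ k * (_ + _ + (∫⁻ u in Set.Ioc (0 : ℝ) n, ∫⁻ y in COL', ie u y) + E0 + _ + _ + _) := h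
        _ ≤ k * (cw * X + cw * X + Ccol * X + X + X + ch * X + ch * X) := by
            refine mul_le_mul_right ?_ _
            refine add_le_add (add_le_add (add_le_add (add_le_add (add_le_add (add_le_add
              (eD.trans aDΦ) (eDd.trans aDΦd)) ((slab_lintegral_mono_set ie COL'_sub).trans hC)) aE0)
              ((hE' n hn).trans aCE)) hP0) hPn
        _ = k * (Cat * X) := by simp only [hCat]; ring
    -- assemble
    calc (∫⁻ u in Set.Ioc (0 : ℝ) n, ∫⁻ y in ZR, (ie u y + iz u y))
        = (∫⁻ u in Set.Ioc (0 : ℝ) n, ∫⁻ y in ZR, ie u y) + ∫⁻ u in Set.Ioc (0 : ℝ) n, ∫⁻ y in ZR, iz u y :=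
          slab_lintegral_add_left _ _ _ _ mie
      _ ≤ ((∫⁻ u in Set.Ioc (0 : ℝ) n, ∫⁻ y in COL, ie u y) + ∫⁻ u in Set.Ioc (0 : ℝ) n, ∫⁻ y in AW, ie u y) +
            ∫⁻ u in Set.Ioc (0 : ℝ) n, ∫⁻ y in ZR, iz u y :=
          add_le_add ((slab_lintegral_mono_set ie ZR_sub).trans (slab_lintegral_union_le _ _ mie)) le_rfl
      _ = (∫⁻ u in Set.Ioc (0 : ℝ) n, ∫⁻ y in COL, ie u y) +
            ((∫⁻ u in Set.Ioc (0 : ℝ) n, ∫⁻ y in AW, ie u y) + ∫⁻ u in Set.Ioc (0 : ℝ) n, ∫⁻ y in ZR, iz u y) :=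
          add_assoc _ _ _
      _ ≤ Ccol * X + k * (Cat * X) := add_le_add hC hA
      _ ≤ Ctot * X := by
          simp only [hCtot]
          calc Ccol * X + k * (Cat * X) = (Ccol + k * Cat) * X := by ring
            _ ≤ (Ccol + k * Cat + 1) * X := mul_le_mul_left le_self_add _
  -- ### the limit `n → ∞`
  have hU : (⋃ n : ℕ, Set.Ioc (0 : ℝ) n) = Set.Ioi 0 := by
    ext u
    simp only [Set.mem_iUnion, Set.mem_Ioc, Set.mem_Ioi]
    constructor
    · rintro ⟨n, h1, _⟩; exact h1
    · intro hu
      obtain ⟨n, hn⟩ := exists_nat_ge u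
      exact ⟨n, hu, hn⟩
  have hdir : Directed (· ⊆ ·) fun n : ℕ ↦ Set.Ioc (0 : ℝ) n :=
    Monotone.directed_le fun m n hmn ↦ Set.Ioc_subset_Ioc le_rfl (Nat.cast_le.mpr hmn)
  calc (∫⁻ u in Set.Ioi (0 : ℝ), ∫⁻ y in ZR, (ie u y + iz u y))
      = ∫⁻ u in ⋃ n : ℕ, Set.Ioc (0 : ℝ) n, ∫⁻ y in ZR, (ie u y + iz u y) := by rw [hU]
    _ = ⨆ n : ℕ, ∫⁻ u in Set.Ioc (0 : ℝ) n, ∫⁻ y in ZR, (ie u y + iz u y) :=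
        setLIntegral_iUnion_of_directed _ hdir
    _ ≤ Ctot * X := iSup_le hstep

end Summit.FinalStateConjecture.FinalStateConjecture.Theorems
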